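import Literature.AnabelianGeometry.EtaleTheta.Discharge.Sec5Lem59iiOfConnectedTemperoidData
import Literature.AnabelianGeometry.EtaleTheta.Discharge.Sec5OfConnectedTemperoidYddFacts
import Literature.AnabelianGeometry.EtaleTheta.Discharge.Sec5TorsionRootsAreUnits

/-!
# [EtTh] §5 over `B^temp(Π^tp_X)⁰` with `A_⊙^bs := Ÿ`: the remaining FACT-row heads of Lemma 5.8 / Lemma 5.9 / §5 p.330–331 as HEAD-EXACT closers

Mochizuki, *The étale theta function and its Frobenioid-theoretic manifestations*, Publ. RIMS **45** (2009), §5 pp. 330–332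
(PDF pp. 104–106 of `paper:doi-10-2977-prims-1234361159`): p.331 "`s^⊔-gp_N` … the resulting section" (the `s^⊔`-side section property);
Lemma 5.8 "`(O_K^×)^{1/N}` is equal to the set of elements of `O^×(B_N)` that normalize the subgroup `E_N ⊆ Aut_C(B_N)`" with its
arithmetic step "this last set is easily seen to coincide with `(O_K^×)^{1/N}`"; Lemma 5.9 (i)/(ii).
[cite: MochizukiEtTh2009, Lem 5.8 p.331 (PDF p.105); §5 p.331 (PDF p.105)]

abc-iut cell, D-0079 ORIGINAL-L / L-F [EtTh] (FACT rows F-0543 `SgpCupSection`, F-0535 `ConstantsActByCyclotome`, F-0536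
`ConstantsEqNormalizer`, F-0538 `KxRootNModCyclotome`, bundle F-2494 `Facts`; cone nodes `EtTh:Lem5.8`, `EtTh:Lem5.9(i)`), seat
abc-iut-w6-d053 (gen 5), companion of the census `LF-ETTH-S5A.tsv`.  PROOF-ONLY (0 definitions, no instance, no new `Prop`):
one-line HEAD-EXACT closers at abc-iut-L2-t4's genuine §5 data `ThetaFrobenioid.ofConnectedTemperoidData` over the Ÿ-choice
`BiKummerSetting.mkOfConnectedTemperoidYdd` (everything consumed BY NAME from `Discharge/Sec5OfConnectedTemperoid.lean`,
`Discharge/Sec5OfConnectedTemperoidYddFacts.lean` (abc-iut-L2-t4), `Discharge/Sec5Lem59iiOfConnectedTemperoidData.lean` (abc-iut-w6-d054),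
`Discharge/Sec5TorsionRootsAreUnits.lean`; nothing landed is edited or restated):
* `sgpCupSection_ofConnectedTemperoidYddData` — **F-0543 with NO binder beyond the data**: `(s^⊔-gp_N(h))^bs = h` on `H_{B_N}`, from
  the `s^⊓`-side section property (`sgpCapSection_ofConnectedTemperoidData`, a theorem for the CONSTRUCTED `s^trv_N`) and Prop. 4.3 (iii)
  (`biKummerDifferenceMem_ofConnectedTemperoidYddData`, a theorem for the Ÿ-choice) via `sgpCupSection_of`;
* `constantsActByCyclotome_ofConnectedTemperoidYddData`, `constantsEqNormalizer_ofConnectedTemperoidYddData` — **F-0535 / F-0536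
  (Lemma 5.8) modulo exactly the two printed arithmetic inputs** `hconst` (Def. 3.6 (iii): automorphisms fix the constants) and `hgc`
  (Lemma 5.8's "geometric connectedness" step: a unit of `B_N` commuting with `s^⊓-gp_N(Im Π^tp_Y)` is a constant) — projections of
  `facts_ofConnectedTemperoidYddData`;
* `lem58_lem59_ofConnectedTemperoidYddData` — the five heads together (Lemma 5.8 main assertion ∧ Lemma 5.9 (i) ∧ (ii) ∧ the two
  section properties) from `{hconst, hgc}`, the last four binder-free.
HONEST FRAMING: [EtTh] is refereed; these are kernel re-keyings of landed theorems (no new mathematics); `hconst`/`hgc` remain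
hypotheses on the constructed tempered Frobenioid (not asserted); the parameter class is not shown inhabited here; nothing here bears on
[IUTchIII] Cor. 3.12 or takes a side; typed ≠ proved for data not of this form.
-/

noncomputable section

namespace Literature.AnabelianGeometry.EtaleTheta

open CategoryTheory Opposite Literature.AlgebraicGeometry.Frobenioids Literature.AnabelianGeometry.SemiGraphs
  Literature.AnabelianGeometry.SemiGraphs.GaloisObjects

universe u₀ v₀ w

namespace ThetaFrobenioid

variable {K : Type u₀} [Field K] {X : SemiGraphs.TemperedArithmeticGroup.{u₀} K} {D₀ : Type u₀} [Category.{v₀} D₀]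
  {V : FrdIMonoidStub.{w}} {T₀ : RealifiedDivisorMonoids (D₀ := D₀) V}
  {VD : FrdICatStub.{u₀ + 1, u₀, w} (ConnectedPart (BTemp X.Pi))}
  {tf : TemperedFrobenioid T₀ (ConnectedPart (BTemp X.Pi)) VD} {hZ : tf.monoidType = MonoidType.Z}
  {hP : ∀ A : (ConnectedPart (BTemp X.Pi))ᵒᵖ, IsPerfect (tf.Φ.carrier A)}
  {NH : Subgroup (Field.absoluteGaloisGroup K) → tf.category → ℕ+ → Prop}
  {lv N : ℕ+} {T : ThetaEnvData.{max u₀ w} N} {ιX : T.PiX ≃ₜ* X.Pi}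
  {pullFrac : ∀ {A A' : (BiKummerSetting.mkOfConnectedTemperoidYdd X tf hZ hP NH T ιX).C} (_ : A' ⟶ A),
    (BiKummerSetting.mkOfConnectedTemperoidYdd X tf hZ hP NH T ιX).biratUnits A →
      (BiKummerSetting.mkOfConnectedTemperoidYdd X tf hZ hP NH T ιX).biratUnits A'}
  {θ : (BiKummerSetting.mkOfConnectedTemperoidYdd X tf hZ hP NH T ιX).biratUnits
    (BiKummerSetting.mkOfConnectedTemperoidYdd X tf hZ hP NH T ιX).Aodot}
  {Bl : (BiKummerSetting.mkOfConnectedTemperoidYdd X tf hZ hP NH T ιX).C}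
  {Pl : (BiKummerSetting.mkOfConnectedTemperoidYdd X tf hZ hP NH T ιX).FractionPair θ Bl}
  {Rl : (BiKummerSetting.mkOfConnectedTemperoidYdd X tf hZ hP NH T ιX).NthRoot θ Pl lv pullFrac}
  (h : ModelFrobenioid.Hypotheses tf.divisorMonoid tf.ratFnFunctor)
  (Q : FrobenioidTheta.ThetaSubquotientStub.{w} (ConnectedPart (BTemp X.Pi))) (odd_l : Odd (lv : ℕ))
  (R : (BiKummerSetting.mkOfConnectedTemperoidYdd X tf hZ hP NH T ιX).NthRoot Rl.root Rl.pair N pullFrac)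
  (K' : Type w) [Field K'] (constEmb : K'ˣ →* tf.biratUnitsModel R.BN) (constEmb_injective : Function.Injective constEmb)
  (hinvc : ∀ g : Aut R.AN.base,
    pull tf.divisorMonoid g.hom (ModelFrobenioid.div R.pair.num) = ModelFrobenioid.div R.pair.num)
  (hinvp : ∀ y : T.PiX, y ∈ T.PiYdd →
    pull tf.divisorMonoid ((BiKummerSetting.mkOfConnectedTemperoidYdd X tf hZ hP NH T ιX).galoisSurj R.AN.base
      R.αData.isGalois (ιX y)).hom (ModelFrobenioid.div R.pair.den) = ModelFrobenioid.div R.pair.den)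

/-! ### F-0543: the `s^⊔`-side section property, binder-free -/

/-- **F-0543 `SgpCupSection` at the genuine §5 data over `B^temp(Π^tp_X)⁰` (`A_⊙^bs := Ÿ`) with NO named input**:
`(s^⊔-gp_N(h))^bs = h` for `h ∈ H_{B_N}` — from the section property of `s^⊓-gp_N` (CONSTRUCTED `s^trv_N`) and the bi-Kummer
cocycle membership of Prop. 4.3 (iii) (a theorem for the Ÿ-choice), via abc-iut-L2-t4's `sgpCupSection_of`.
[cite: MochizukiEtTh2009, §5 p.331 (PDF p.105)] -/
theorem sgpCupSection_ofConnectedTemperoidYddData :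
    (ofConnectedTemperoidData h Q odd_l R ιX K' constEmb constEmb_injective hinvc hinvp).SgpCupSection :=
  (ofConnectedTemperoidData h Q odd_l R ιX K' constEmb constEmb_injective hinvc hinvp).sgpCupSection_of
    (sgpCapSection_ofConnectedTemperoidData h Q odd_l R ιX K' constEmb constEmb_injective hinvc hinvp)
    (biKummerDifferenceMem_ofConnectedTemperoidYddData h Q odd_l R K' constEmb constEmb_injective hinvc hinvp)

/-! ### F-0535 / F-0536 (Lemma 5.8) modulo the two printed arithmetic inputs `hconst`, `hgc` -/

section Constants

variable
  (hconst : ∀ (e : Aut R.BN) (k : K'ˣ), tf.biratAutModel R.BN e (constEmb k) = constEmb k)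
  (hgc : ∀ u : (ofConnectedTemperoidData h Q odd_l R ιX K' constEmb constEmb_injective hinvc hinvp).units
      (ofConnectedTemperoidData h Q odd_l R ιX K' constEmb constEmb_injective hinvc hinvp).BN,
    (∀ y ∈ (ofConnectedTemperoidData h Q odd_l R ιX K' constEmb constEmb_injective hinvc hinvp).imPiY,
      (ofConnectedTemperoidData h Q odd_l R ιX K' constEmb constEmb_injective hinvc hinvp).sgpCap y *
        (u : Aut (ofConnectedTemperoidData h Q odd_l R ιX K' constEmb constEmb_injective hinvc hinvp).BN) *
        ((ofConnectedTemperoidData h Q odd_l R ιX K' constEmb constEmb_injective hinvc hinvp).sgpCap y)⁻¹ = u) →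
    (ofConnectedTemperoidData h Q odd_l R ιX K' constEmb constEmb_injective hinvc hinvp).unitsToBirat
        (ofConnectedTemperoidData h Q odd_l R ιX K' constEmb constEmb_injective hinvc hinvp).BN u ∈
      (ofConnectedTemperoidData h Q odd_l R ιX K' constEmb constEmb_injective hinvc hinvp).constEmb.range)

include hconst hgc

/-- **F-0535 `ConstantsActByCyclotome` (Lemma 5.8, arithmetic step) at the genuine §5 data over `B^temp(Π^tp_X)⁰`** modulo exactly
`hconst` (Def. 3.6 (iii)) and `hgc` (geometric connectedness of `Ÿ` over `K`) — projection of abc-iut-L2-t4's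
`facts_ofConnectedTemperoidYddData`.  [cite: MochizukiEtTh2009, Lem 5.8 p.331 (PDF p.105)] -/
theorem constantsActByCyclotome_ofConnectedTemperoidYddData :
    (ofConnectedTemperoidData h Q odd_l R ιX K' constEmb constEmb_injective hinvc hinvp).ConstantsActByCyclotome :=
  (facts_ofConnectedTemperoidYddData h Q odd_l R K' constEmb constEmb_injective hinvc hinvp hconst hgc).constantsActByCyclotome

/-- **F-0536 `ConstantsEqNormalizer` (Lemma 5.8, main assertion: "`(O_K^×)^{1/N}` = the elements of `O^×(B_N)` normalising `E_N`") at
the genuine §5 data over `B^temp(Π^tp_X)⁰`** modulo `hconst`, `hgc` — the group-theoretic step being abc-iut-L2-t4's theorem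
`constantsEqNormalizer_of` and the section property a theorem for the constructed `s^trv_N`.  [cite: MochizukiEtTh2009, Lem 5.8 p.331 (PDF p.105)] -/
theorem constantsEqNormalizer_ofConnectedTemperoidYddData :
    (ofConnectedTemperoidData h Q odd_l R ιX K' constEmb constEmb_injective hinvc hinvp).ConstantsEqNormalizer :=
  (facts_ofConnectedTemperoidYddData h Q odd_l R K' constEmb constEmb_injective hinvc hinvp hconst hgc).constantsEqNormalizer

/-- **Lemma 5.8 ∧ Lemma 5.9 (i) ∧ (ii) ∧ the two section properties at the genuine §5 data over `B^temp(Π^tp_X)⁰` (`A_⊙^bs := Ÿ`)**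
from `{hconst, hgc}` — the last four conjuncts binder-free (abc-iut-w6-d054's `sectionsFactor_…` / `enExact_…YddData`,
abc-iut-L2-t4's `sgpCapSection_…`, and `sgpCupSection_…` above).  [cite: MochizukiEtTh2009, Lem 5.8 p.331 (PDF p.105); Lem 5.9 (i)(ii) p.331–332 (PDF pp.105–106)] -/
theorem lem58_lem59_ofConnectedTemperoidYddData :
    (ofConnectedTemperoidData h Q odd_l R ιX K' constEmb constEmb_injective hinvc hinvp).ConstantsEqNormalizer ∧
      (ofConnectedTemperoidData h Q odd_l R ιX K' constEmb constEmb_injective hinvc hinvp).SectionsFactor ∧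
      (ofConnectedTemperoidData h Q odd_l R ιX K' constEmb constEmb_injective hinvc hinvp).ENExact ∧
      (ofConnectedTemperoidData h Q odd_l R ιX K' constEmb constEmb_injective hinvc hinvp).SgpCapSection ∧
      (ofConnectedTemperoidData h Q odd_l R ιX K' constEmb constEmb_injective hinvc hinvp).SgpCupSection :=
  ⟨constantsEqNormalizer_ofConnectedTemperoidYddData h Q odd_l R K' constEmb constEmb_injective hinvc hinvp hconst hgc,
    sectionsFactor_ofConnectedTemperoidYddData h Q odd_l R K' constEmb constEmb_injective hinvc hinvp,
    enExact_ofConnectedTemperoidYddData h Q odd_l R K' constEmb constEmb_injective hinvc hinvp,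
    sgpCapSection_ofConnectedTemperoidData h Q odd_l R ιX K' constEmb constEmb_injective hinvc hinvp,
    sgpCupSection_ofConnectedTemperoidYddData h Q odd_l R K' constEmb constEmb_injective hinvc hinvp⟩

end Constants

end ThetaFrobenioid

end Literature.AnabelianGeometry.EtaleTheta

end
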